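import Literature.Analysis.FluidPDE.TypeIAncientMildClassical
import Literature.Analysis.FluidPDE.SwirlMaximumPrinciple
import Literature.Analysis.FluidPDE.MeridianReduction
import Mathlib.Analysis.SpecialFunctions.Pow.Deriv
import Summits.NavierStokesRegularity.NavierStokesRegularity.Theorems.SymmetryModuliCountAxisymEndLiouvilleStubCylProfileCalculus

/-!
# Weighted maximum principle for the swirl — tools (line `absorbing-axis-swirl-extinction`)

Support file for the stub `stub_swirlComparison` of the crux `AxisymEndLiouville`
(stmt-NavierStokesRegularity-14061, route SymmetryModuliCount): one-variable calculus of the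
comparison function `M (s/t')^λ W(r/√(−s))` and the **sub-solution step** at an off-axis
critical point of `σΓ − Ψ − ψ` — the swirl equation (KNSS 2009 (1.8)), the Type-I drift
bound and the profile inequality `W'' − (ρ/2 + 1/ρ − C)W' + λW ≤ 0` give `∂ₛ(σΓ − Ψ − ψ) ≤ 0`
there.  The comparison itself is in `SymmetryModuliCountAxisymEndLiouvilleStubSwirlComparison`.
-/

noncomputable section

-- the summit and its single problem share the name (D-0017 nested layout)
set_option linter.dupNamespace false

open Set Function Filter Topology MeasureTheory InnerProductSpace Metric
open scoped RealInnerProductSpace Laplacian ContDiff NNReal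

namespace Summit.NavierStokesRegularity.NavierStokesRegularity.Theorems.AxisymEndLiouville.AbsorbingAxisSwirlExtinction

open Literature.Analysis.FluidPDE

/-- `ℝ³`. -/
local notation "E3" => EuclideanSpace ℝ (Fin 3)

/-! ### One-variable calculus of the comparison function -/

/-- `d/ds (s/t')^λ = λ (s/t')^λ / s` for `s, t' < 0`. -/
theorem hasDerivAt_rpow_ratio {t' s : ℝ} (lam : ℝ) (ht' : t' < 0) (hs : s < 0) :
    HasDerivAt (fun σ : ℝ => (σ / t') ^ lam) (lam * (s / t') ^ lam / s) s := by
  have hpos : 0 < s / t' := div_pos_of_neg_of_neg hs ht'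
  have h1 : HasDerivAt (fun σ : ℝ => σ / t') (1 / t') s := by
    simpa using (hasDerivAt_id s).div_const t'
  have h2 := h1.rpow_const (p := lam) (Or.inl hpos.ne')
  refine h2.congr_deriv ?_
  rw [Real.rpow_sub_one hpos.ne']
  have ht'0 : t' ≠ 0 := ht'.ne
  have hs0 : s ≠ 0 := hs.ne
  field_simp

/-- `d/ds (r/√(−s)) = (r/√(−s)) / (2(−s))` for `s < 0`. -/
theorem hasDerivAt_div_sqrt_neg (r : ℝ) {s : ℝ} (hs : s < 0) :
    HasDerivAt (fun σ : ℝ => r / Real.sqrt (-σ)) (r / Real.sqrt (-s) / (2 * (-s))) s := by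
  have hns : 0 < -s := neg_pos.2 hs
  have hsq : Real.sqrt (-s) ≠ 0 := (Real.sqrt_pos.2 hns).ne'
  have h1 : HasDerivAt (fun σ : ℝ => Real.sqrt (-σ)) (1 / (2 * Real.sqrt (-s)) * (-1)) s :=
    (Real.hasDerivAt_sqrt hns.ne').comp s (hasDerivAt_neg s)
  have h2 := (h1.inv hsq).const_mul r
  have e : (fun σ : ℝ => r / Real.sqrt (-σ)) = fun σ => r * (Real.sqrt (-σ))⁻¹ := by
    funext σ; rw [div_eq_mul_inv]
  rw [e]
  refine h2.congr_deriv ?_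
  have hss : Real.sqrt (-s) ^ 2 = -s := Real.sq_sqrt hns.le
  have hs0 : s ≠ 0 := hs.ne
  field_simp
  rw [hss]
  field_simp

/-- Time derivative of the comparison function `s ↦ M (s/t')^λ W(r/√(−s))` at `s < 0`. -/
theorem hasDerivAt_comparison_time {t' s : ℝ} (M lam r : ℝ) {W : ℝ → ℝ} {W₁ : ℝ} (ht' : t' < 0)
    (hs : s < 0) (hW : HasDerivAt W W₁ (r / Real.sqrt (-s))) :
    HasDerivAt (fun σ : ℝ => M * (σ / t') ^ lam * W (r / Real.sqrt (-σ)))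
      (M * (lam * (s / t') ^ lam / s * W (r / Real.sqrt (-s)) +
        (s / t') ^ lam * (W₁ * (r / Real.sqrt (-s) / (2 * (-s)))))) s := by
  have h := ((hasDerivAt_rpow_ratio lam ht' hs).mul
    (hW.comp s (hasDerivAt_div_sqrt_neg r hs))).const_mul M
  have e : (fun σ : ℝ => M * (σ / t') ^ lam * W (r / Real.sqrt (-σ))) =
      fun σ => M * ((σ / t') ^ lam * (W ∘ fun σ : ℝ => r / Real.sqrt (-σ)) σ) := by
    funext σ; simp only [comp_apply]; ring
  rw [e]
  exact h

/-! ### Small real-variable helpers (kept outside the main proofs for speed) -/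

/-- `‖e_r‖ ≤ 1` (it is `1` off the axis and `0` on it). -/
theorem norm_eR_le_one' (y : EuclideanSpace ℝ (Fin 3)) : ‖eR y‖ ≤ 1 := by
  by_cases hy : cylRadius y = 0
  · simp [eR, hy]
  · have h : ‖eR y‖ ^ 2 = 1 := by rw [← real_inner_self_eq_norm_sq, inner_eR_self hy]
    nlinarith [norm_nonneg (eR y)]

/-- If `|p| ≤ B` and `A ≥ 0` then `-(A p) ≤ A B`. -/
theorem neg_mul_le_of_abs_le {A p B : ℝ} (hA : 0 ≤ A) (h : |p| ≤ B) : -(A * p) ≤ A * B := by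
  have := (abs_le.1 h).1
  nlinarith

/-- The escape-barrier inequality `6 + 2 n V ≤ (6 + V + 1)(1 + n²)` for `V ≥ 0`
(`= −1 − 7n² − V(n−1)²`). -/
theorem barrier_ineq (n : ℝ) {V : ℝ} (hV : 0 ≤ V) :
    6 + 2 * (n * V) - (6 + V + 1) * (1 + n ^ 2) ≤ 0 := by
  nlinarith [sq_nonneg (n - 1), sq_nonneg n, mul_nonneg (sq_nonneg (n - 1)) hV]

/-- For `W` of class `C²` on `(0,∞)`, `deriv W` is the derivative at every `ρ > 0`. -/
theorem hasDerivAt_deriv_of_contDiffOn {W : ℝ → ℝ} (hW2 : ContDiffOn ℝ 2 W (Ioi 0)) {ρ : ℝ}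
    (hρ : 0 < ρ) : HasDerivAt W (deriv W ρ) ρ :=
  ((hW2.differentiableOn (by norm_num)).differentiableAt (Ioi_mem_nhds hρ)).hasDerivAt

/-! ### The sub-solution step at an interior critical point -/

/-- **The sub-solution implication at an off-axis critical point.**  At a point `y` off the
axis where the comparison slice `z ↦ σΓ(z) − Mφ W(r(z)/√(−s)) − c(1+|z|²)` has vanishing
gradient and nonpositive Laplacian, the swirl equation (`G` = the time derivative of `Γ` at
`(s, y)`), the Type-I bounds `|v(y)| ≤ C/√(−s)`, `|v(y)| ≤ V` and the profile inequality give
`σ G − Ψₜ − β c (1 + |y|²) ≤ 0` for `β ≥ 6 + V + 1`, where `Ψₜ` is the time derivative of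
`M (s/t')^λ W(r/√(−s))` written with `φ = (s/t')^λ`, `dφ/ds = λφ/s`. -/
theorem subsolution_step {C lam M φ σ c V β s G : ℝ} {W : ℝ → ℝ} {v : E3 → E3} {y : E3}
    (hW2 : ContDiffOn ℝ 2 W (Ioi 0)) (hW1 : ∀ ρ, 0 < ρ → 0 ≤ deriv W ρ)
    (hWineq : ∀ ρ, 0 < ρ → deriv (deriv W) ρ - (ρ / 2 + 1 / ρ - C) * deriv W ρ + lam * W ρ ≤ 0)
    (hM : 0 ≤ M) (hφ0 : 0 ≤ φ) (hc : 0 < c) (hV : 0 ≤ V) (hβ : 6 + V + 1 ≤ β) (hs : s < 0)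
    (hv2 : ContDiff ℝ 2 v) (hvC : ‖v y‖ ≤ C / Real.sqrt (-s)) (hvV : ‖v y‖ ≤ V)
    (hy : cylRadius y ≠ 0)
    (hpde : G + fderiv ℝ (swirl v) y (v y) =
      (Δ (swirl v)) y - 2 / cylRadius y * fderiv ℝ (swirl v) y (eR y))
    (hgrad : fderiv ℝ (fun z => σ * swirl v z - M * φ * W (cylRadius z / Real.sqrt (-s)) -
      c * (1 + ‖z‖ ^ 2)) y = 0)
    (hlap : (Δ (fun z : E3 => (σ * swirl v z - M * φ * W (cylRadius z / Real.sqrt (-s)) -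
      c * (1 + ‖z‖ ^ 2) : ℝ))) y ≤ 0) :
    σ * G - M * (lam * φ / s * W (cylRadius y / Real.sqrt (-s)) +
        φ * (deriv W (cylRadius y / Real.sqrt (-s)) *
          (cylRadius y / Real.sqrt (-s) / (2 * (-s))))) -
      β * (c * (1 + ‖y‖ ^ 2)) ≤ 0 := by
  have hr0 : 0 < cylRadius y := lt_of_le_of_ne (cylRadius_nonneg y) (Ne.symm hy)
  have hns : 0 < -s := neg_pos.2 hs
  have hsqrt : 0 < Real.sqrt (-s) := Real.sqrt_pos.2 hns
  -- the profile calculus at `y`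
  obtain ⟨hPc2, hPgrad, hPlap⟩ := stub_cylProfileCalculus W hW2 (Real.sqrt (-s)) hsqrt y hy
  -- scalar abbreviations (made opaque)
  set sq : ℝ := Real.sqrt (-s) with hsq
  have hsq2 : sq ^ 2 = -s := by rw [hsq]; exact Real.sq_sqrt hns.le
  set r : ℝ := cylRadius y with hrdef
  set ρ : ℝ := r / sq with hρdef
  have hρ0 : 0 < ρ := div_pos hr0 hsqrt
  set W₀ : ℝ := W ρ with hW₀
  set W₁ : ℝ := deriv W ρ with hW₁
  set W₂ : ℝ := deriv (deriv W) ρ with hW₂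
  have hW₁0 : 0 ≤ W₁ := hW1 ρ hρ0
  have hMφ0 : 0 ≤ M * φ := mul_nonneg hM hφ0
  set P : E3 → ℝ := fun z => W (cylRadius z / sq) with hP
  set n : ℝ := ‖y‖ with hn
  clear_value sq r ρ W₀ W₁ W₂ n
  have hr' : cylRadius y ≠ 0 := by rw [← hrdef]; exact hr0.ne'
  have hsq0 : 0 < sq := hsqrt
  -- the three pieces
  have hΓc2 : ContDiffAt ℝ 2 (fun z => σ * swirl v z) y :=
    (contDiff_const.mul (contDiff_swirl hv2)).contDiffAt
  have hΨc2 : ContDiffAt ℝ 2 (fun z => M * φ * P z) y := contDiffAt_const.mul hPc2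
  have hψc2 : ContDiffAt ℝ 2 (fun z : E3 => c * (1 + ‖z‖ ^ 2)) y :=
    (contDiff_const.mul (contDiff_const.add (contDiff_norm_sq ℝ))).contDiffAt
  have hwfun : (fun z => σ * swirl v z - M * φ * W (cylRadius z / sq) - c * (1 + ‖z‖ ^ 2)) =
      (fun z => σ * swirl v z) - (fun z => M * φ * P z) - fun z : E3 => c * (1 + ‖z‖ ^ 2) := by
    funext z; simp only [hP, Pi.sub_apply]
  rw [hwfun] at hgrad hlap
  -- derivatives of the pieces
  have hΓd : DifferentiableAt ℝ (swirl v) y :=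
    differentiableAt_swirl ((hv2.differentiable (by norm_num)) y)
  have hPd : DifferentiableAt ℝ P y := hPc2.differentiableAt (by norm_num)
  have hBar : HasFDerivAt (fun z : E3 => c * (1 + ‖z‖ ^ 2))
      (c • ((2 : ℕ) • (innerSL ℝ y : E3 →L[ℝ] ℝ))) y := by
    have := hasFDerivAt_barrier 0 c y
    simpa only [zero_add] using this
  have hwderiv : HasFDerivAt
      ((fun z => σ * swirl v z) - (fun z => M * φ * P z) - fun z : E3 => c * (1 + ‖z‖ ^ 2))
      (σ • fderiv ℝ (swirl v) y - (M * φ) • fderiv ℝ P y -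
        c • ((2 : ℕ) • (innerSL ℝ y : E3 →L[ℝ] ℝ))) y :=
    ((hΓd.hasFDerivAt.const_mul σ).sub (hPd.hasFDerivAt.const_mul (M * φ))).sub hBar
  have hDeq : σ • fderiv ℝ (swirl v) y =
      (M * φ) • fderiv ℝ P y + c • ((2 : ℕ) • (innerSL ℝ y : E3 →L[ℝ] ℝ)) := by
    have h1 := hwderiv.fderiv
    rw [hgrad] at h1
    have h2 := h1.symm
    rw [sub_sub, sub_eq_zero] at h2
    exact h2
  have hDapply : ∀ w : E3, σ * fderiv ℝ (swirl v) y w =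
      M * φ * (W₁ / sq * ⟪eR y, w⟫) + c * (2 * ⟪y, w⟫) := by
    intro w
    have h1 := congrArg (fun L : E3 →L[ℝ] ℝ => L w) hDeq
    have h2 : σ * fderiv ℝ (swirl v) y w = M * φ * fderiv ℝ P y w + c * (2 * ⟪y, w⟫) := by
      simpa [innerSL_apply_apply, nsmul_eq_mul] using h1
    rw [h2, hPgrad w]
  -- Laplacians
  have hΔ : σ * (Δ (swirl v)) y ≤ M * φ * ((W₂ + W₁ / ρ) / sq ^ 2) + 6 * c := by
    have e1 : (Δ (fun z => σ * swirl v z)) y = σ * (Δ (swirl v)) y := by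
      have : (fun z => σ * swirl v z) = σ • swirl v := by
        funext z; simp [smul_eq_mul]
      rw [this, laplacian_smul σ ((contDiff_swirl hv2).contDiffAt), smul_eq_mul]
    have e2 : (Δ (fun z => M * φ * P z)) y = M * φ * (Δ P) y := by
      have : (fun z => M * φ * P z) = (M * φ) • P := by
        funext z; simp [smul_eq_mul]
      rw [this, laplacian_smul (M * φ) hPc2, smul_eq_mul]
    have e3 : (Δ (fun z : E3 => (c * (1 + ‖z‖ ^ 2) : ℝ))) y = 6 * c := by
      have := laplacian_barrier 0 c y
      simpa only [zero_add] using this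
    have hAB : ContDiffAt ℝ 2 ((fun z => σ * swirl v z) - fun z => M * φ * P z) y :=
      hΓc2.sub hΨc2
    rw [hAB.laplacian_sub hψc2, hΓc2.laplacian_sub hΨc2, e1, e2, e3, hPlap] at hlap
    linarith
  -- the swirl equation
  have hΓeq : G = (Δ (swirl v)) y - 2 / r * fderiv ℝ (swirl v) y (eR y) -
      fderiv ℝ (swirl v) y (v y) := eq_sub_of_add_eq hpde
  -- the drift terms at the critical point
  have heR1 : ⟪eR y, eR y⟫ = 1 := inner_eR_self hr'
  have hrad : 0 ≤ c * (2 * ⟪y, eR y⟫) := by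
    have := inner_self_eR_nonneg y
    positivity
  have hconv1 : -(M * φ * (W₁ / sq * ⟪eR y, v y⟫)) ≤ M * φ * (W₁ / sq * (C / sq)) := by
    have h1 : |⟪eR y, v y⟫| ≤ C / sq := by
      calc |⟪eR y, v y⟫| ≤ ‖eR y‖ * ‖v y‖ := abs_real_inner_le_norm _ _
        _ ≤ 1 * (C / sq) := mul_le_mul (norm_eR_le_one' y) hvC (norm_nonneg _) zero_le_one
        _ = C / sq := one_mul _
    have h3 : 0 ≤ M * φ * (W₁ / sq) := mul_nonneg hMφ0 (div_nonneg hW₁0 hsq0.le)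
    have e1 : M * φ * (W₁ / sq * ⟪eR y, v y⟫) = M * φ * (W₁ / sq) * ⟪eR y, v y⟫ := by ring
    have e2 : M * φ * (W₁ / sq * (C / sq)) = M * φ * (W₁ / sq) * (C / sq) := by ring
    rw [e1, e2]
    exact neg_mul_le_of_abs_le h3 h1
  have hconv2 : -(c * (2 * ⟪y, v y⟫)) ≤ c * (2 * (n * V)) := by
    have h1 : |⟪y, v y⟫| ≤ n * V := by
      rw [hn]
      exact (abs_real_inner_le_norm _ _).trans (mul_le_mul_of_nonneg_left hvV (norm_nonneg _))
    have e1 : c * (2 * ⟪y, v y⟫) = c * 2 * ⟪y, v y⟫ := by ring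
    have e2 : c * (2 * (n * V)) = c * 2 * (n * V) := by ring
    rw [e1, e2]
    exact neg_mul_le_of_abs_le (by positivity) h1
  -- `σ G ≤ (Mφ/sq²) [W'' − W'/ρ + C W'] + c (6 + 2 n V)`
  have hΓt : σ * G ≤ M * φ / sq ^ 2 * (W₂ - W₁ / ρ + C * W₁) + c * (6 + 2 * (n * V)) := by
    have e : σ * G = σ * (Δ (swirl v)) y -
        2 / r * (σ * fderiv ℝ (swirl v) y (eR y)) - σ * fderiv ℝ (swirl v) y (v y) := by
      rw [hΓeq]; ring
    rw [e, hDapply (eR y), hDapply (v y), heR1, mul_one]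
    have h2r : 0 < 2 / r := div_pos two_pos hr0
    have hA : 2 / r * (M * φ * (W₁ / sq)) ≤ 2 / r * (M * φ * (W₁ / sq) + c * (2 * ⟪y, eR y⟫)) := by
      have h0 : 0 ≤ 2 / r * (c * (2 * ⟪y, eR y⟫)) := mul_nonneg h2r.le hrad
      have e' : 2 / r * (M * φ * (W₁ / sq) + c * (2 * ⟪y, eR y⟫)) =
          2 / r * (M * φ * (W₁ / sq)) + 2 / r * (c * (2 * ⟪y, eR y⟫)) := by ring
      linarith
    have hrρ : r = ρ * sq := by rw [hρdef]; field_simp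
    have hρne : ρ ≠ 0 := hρ0.ne'
    have hsqne : sq ≠ 0 := hsq0.ne'
    have i1 : 2 / r * (M * φ * (W₁ / sq)) = M * φ / sq ^ 2 * (2 * W₁ / ρ) := by
      rw [hrρ]; field_simp
    have i2 : M * φ * (W₁ / sq * (C / sq)) = M * φ / sq ^ 2 * (C * W₁) := by
      field_simp
    have i3 : M * φ * ((W₂ + W₁ / ρ) / sq ^ 2) = M * φ / sq ^ 2 * (W₂ + W₁ / ρ) := by
      field_simp
    have i4 : M * φ / sq ^ 2 * (W₂ + W₁ / ρ) - M * φ / sq ^ 2 * (2 * W₁ / ρ) +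
        M * φ / sq ^ 2 * (C * W₁) = M * φ / sq ^ 2 * (W₂ - W₁ / ρ + C * W₁) := by ring
    linarith [hΔ, hA, hconv1, hconv2, i1, i2, i3, i4]
  -- `Ψₜ = (Mφ/sq²) (−λ W + (ρ/2) W')`
  have hΨt : M * (lam * φ / s * W₀ + φ * (W₁ * (ρ / (2 * (-s))))) =
      M * φ / sq ^ 2 * (-(lam * W₀) + ρ / 2 * W₁) := by
    have hs' : s = -(sq ^ 2) := by rw [hsq2, neg_neg]
    rw [hs']
    have hsqne : sq ≠ 0 := hsq0.ne'
    field_simp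
  -- conclude
  have hbracket : M * φ / sq ^ 2 * (W₂ - (ρ / 2 + 1 / ρ - C) * W₁ + lam * W₀) ≤ 0 :=
    mul_nonpos_of_nonneg_of_nonpos (div_nonneg hMφ0 (sq_nonneg _))
      (by rw [hW₂, hW₁, hW₀]; exact hWineq ρ hρ0)
  have hbar : c * (6 + 2 * (n * V)) - β * (c * (1 + n ^ 2)) ≤ 0 := by
    have e : c * (6 + 2 * (n * V)) - (6 + V + 1) * (c * (1 + n ^ 2)) =
        c * (6 + 2 * (n * V) - (6 + V + 1) * (1 + n ^ 2)) := by ring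
    have h1 : c * (6 + 2 * (n * V)) - (6 + V + 1) * (c * (1 + n ^ 2)) ≤ 0 := by
      rw [e]
      exact mul_nonpos_of_nonneg_of_nonpos hc.le (barrier_ineq n hV)
    have h2 : (6 + V + 1) * (c * (1 + n ^ 2)) ≤ β * (c * (1 + n ^ 2)) :=
      mul_le_mul_of_nonneg_right hβ (by positivity)
    linarith
  have e4 : M * φ / sq ^ 2 * (W₂ - W₁ / ρ + C * W₁) -
      M * φ / sq ^ 2 * (-(lam * W₀) + ρ / 2 * W₁) =
      M * φ / sq ^ 2 * (W₂ - (ρ / 2 + 1 / ρ - C) * W₁ + lam * W₀) := by ring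
  rw [hΨt]
  linarith [hΓt, hbracket, hbar, e4]


end Summit.NavierStokesRegularity.NavierStokesRegularity.Theorems.AxisymEndLiouville.AbsorbingAxisSwirlExtinction

end
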